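import Literature.Analysis.FluidPDE.KNSSTypeIRateLiouvilleDescent
import Literature.Analysis.FluidPDE.KNSSLiouvillePlanarHolds
import Literature.Analysis.FluidPDE.KNSSTypeIRateMildHolds
import Literature.Analysis.FluidPDE.KNSSTypeIRateCompactnessHolds
import Literature.Analysis.FluidPDE.KNSSThm53OfWindow
import Literature.Analysis.FluidPDE.KNSSTypeIIProofs
import Literature.Analysis.FluidPDE.KNSSTypeIIHolds
import HarnessLib

/-!
# KNSS 2009, Theorem 6.2: the Liouville step discharged, and with it Theorems 6.1 and 6.2

Analysis/FluidPDE proof file (everything proved; no definitions, no named facts), sibling of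
`KNSSTypeIRateLiouville.lean`, discharging the named fact
`Literature.Analysis.FluidPDE.KNSS2009_typeI_rate_liouville_horizontal` (Koch–Nadirashvili–
Seregin–Šverák, *Liouville theorems for the Navier–Stokes equations and applications*, Acta Math.
203 (2009) 83–105 = arXiv:0709.3599, proof of Theorem 6.2, p. 13: "Applying Theorem 5.1 and
Remark 6.1 to the field `(w₁, w₃)`, we conclude that `(w₁, w₃)` must vanish identically") and
composing the accepted reductions of the tree into the discharges that this closes:

* `KNSS2009_typeI_rate_liouville_horizontal_holds` — the planar half of the Liouville step:
  the accepted reduction to Theorem 5.1 as printed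
  (`KNSS2009_typeI_rate_liouville_horizontal_of_planar`, `KNSSTypeIRateLiouvilleDescent`: an
  Oseen-mild bounded continuous ancient field is a bounded weak solution on `ℝ³ × (−∞, 0)`, its
  planar trace along the ignorable coordinate is a bounded weak solution on `ℝ² × (−∞, 0)`,
  Theorem 5.1 makes it `β(t)`, Remark 6.1 and the decay `√(−t)|w| ≤ C` kill `β`) fed with
  Theorem 5.1, which is now a theorem of the tree (`KNSS2009_liouville_planar_holds`,
  `KNSSLiouvillePlanarHolds`: §4 for bounded mild solutions, proved, then Lemma 2.1 and the
  vorticity argument of §5);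
* `KNSS2009_typeI_rate_liouville_holds` — the whole Liouville step ("… and this easily implies
  that `w = 0`", the axial half `KNSS2009_typeI_rate_liouville_axial` being proved in
  `KNSSTypeIRateLiouville`);
* `KNSS2009_typeI_rate_blowupSequence_holds`, `KNSS2009_typeI_rate_mildBlowupSequence_holds`,
  `KNSS2009_typeI_rate_rMulNorm_bounded_holds` — Steps 5–6 and the main step of the proof of
  Theorem 6.2 (compactness = Lemma 6.1 and the vertex estimate being discharged in
  `KNSSTypeIRateCompactnessHolds`, `KNSSMildDecayProofs`, `KNSSTypeIRateMildHolds`);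
* `KNSS2009_regularity_bound_C_over_r_holds` — **Theorem 6.1**, by the accepted reduction
  `KNSS2009_regularity_bound_C_over_r_of_window_of_liouville` (`KNSSTypeIIProofs`) to §4 on finite
  windows and Theorem 5.3, both discharged in `KNSSThm53OfWindow`
  (`KNSS2009_regularity_boundedWeak_window_holds`, `KNSS2009_liouville_bound_C_over_r_holds`);
* `KNSS2009_regularity_typeI_rate_holds` — **Theorem 6.2** as vendored (`KNSSTypeII`), from
  Theorem 6.1 and the Liouville step (`KNSS2009_regularity_typeI_rate_of_bound_C_over_r_of_liouville`,
  `KNSSTypeIRateMildHolds`);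
* the two continuation statements of KNSS §6 (Remark 6.2: Theorems 6.1 and 6.2 exclude blow-up
  for axisymmetric Leray–Hopf classical solutions with `r|u| ≤ C`, resp. with the Type I rate and
  `r|u| ≤ C` far from the axis), unconditionally:
  `hasSmoothExtensionPast_of_axisymmetric_of_cylRadius_mul_norm_le` and
  `hasSmoothExtensionPast_of_axisymmetric_typeI_of_decay` (the accepted conditional forms
  `hasSmoothExtensionPast_of_cylRadius_mul_norm_le`, `hasSmoothExtensionPast_of_typeI_of_decay` of
  `KNSSTypeII` fed with the discharges above and with the continuation of bounded Leray–Hopf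
  solutions, `hasSmoothExtensionPast_of_bounded_holds`, `KNSSTypeIIHolds`).

Every theorem here is a composition of accepted tree theorems; the mathematics is in the files
named above.

## References

* G. Koch, N. Nadirashvili, G. Seregin, V. Šverák, *Liouville theorems for the Navier–Stokes
  equations and applications*, Acta Math. 203 (2009) 83–105 = arXiv:0709.3599 (arXiv pages):
  Theorem 5.1 p. 9; Remark 6.1 p. 11; Theorem 6.1 p. 11 and its proof p. 12; Theorem 6.2 p. 12
  and its proof pp. 12–13 (the Liouville sentence: p. 13); Remark 6.2 p. 11.
  [KochNadirashviliSereginSverak2009]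
* J. C. Robinson, J. L. Rodrigo, W. Sadowski, *The Three-Dimensional Navier–Stokes Equations*,
  CUP (2016), Thm. 8.17 (continuation of bounded Leray–Hopf solutions). [RobinsonRodrigoSadowski2016]
-/

noncomputable section

open Set

namespace Literature.Analysis.FluidPDE

/-! ### The Liouville step of the proof of Theorem 6.2 -/

/-- **KNSS 2009, proof of Theorem 6.2, Liouville step, planar half — discharged**: the named
fact `KNSS2009_typeI_rate_liouville_horizontal` holds ("Applying Theorem 5.1 and Remark 6.1 to
the field `(w₁, w₃)`, we conclude that `(w₁, w₃)` must vanish identically"), by the accepted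
reduction to Theorem 5.1 (`KNSS2009_typeI_rate_liouville_horizontal_of_planar`: descent of the
`x₂`-independent bounded weak solution to the plane, Theorem 5.1, continuity, Remark 6.1, decay)
and Theorem 5.1 proved (`KNSS2009_liouville_planar_holds`). [cite: KochNadirashviliSereginSverak2009, proof of Thm 6.2 (arXiv p. 13) with Thm 5.1 (p. 9) and Remark 6.1 (p. 11)] -/
theorem KNSS2009_typeI_rate_liouville_horizontal_holds :
    KNSS2009_typeI_rate_liouville_horizontal :=
  KNSS2009_typeI_rate_liouville_horizontal_of_planar KNSS2009_liouville_planar_holds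

/-- **KNSS 2009, proof of Theorem 6.2, the Liouville step — discharged**: the named fact
`KNSS2009_typeI_rate_liouville` of `KNSSTypeIRateCore` holds (the blow-up limit `w`, an
`x₂`-independent bounded ancient mild solution with `√(−t)|w| ≤ C`, vanishes: planar half
`KNSS2009_typeI_rate_liouville_horizontal_holds`, axial half
`KNSS2009_typeI_rate_liouville_axial` through `KNSS2009_typeI_rate_liouville_of_horizontal`). [cite: KochNadirashviliSereginSverak2009, proof of Thm 6.2 (arXiv p. 13) with Thm 5.1 (p. 9) and Remark 6.1 (p. 11)] -/
theorem KNSS2009_typeI_rate_liouville_holds : KNSS2009_typeI_rate_liouville :=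
  KNSS2009_typeI_rate_liouville_of_horizontal KNSS2009_typeI_rate_liouville_horizontal_holds

/-! ### Steps 5–6 and the main step of the proof of Theorem 6.2 -/

/-- **KNSS 2009, proof of Theorem 6.2, Steps 5–6 (`w⁽ᵏ⁾(0, 0) → 0`) — discharged**: the named
fact `KNSS2009_typeI_rate_blowupSequence` of `KNSSTypeIRate` holds, by
`KNSS2009_typeI_rate_blowupSequence_of_core` fed with the three discharged ingredients
(compactness `KNSS2009_typeI_rate_compactness_holds`, Liouville
`KNSS2009_typeI_rate_liouville_holds`, vertex `KNSS2009_typeI_rate_vertex_holds`). [cite: KochNadirashviliSereginSverak2009, proof of Thm 6.2, Steps 5–6 (arXiv p. 13)] -/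
theorem KNSS2009_typeI_rate_blowupSequence_holds : KNSS2009_typeI_rate_blowupSequence :=
  KNSS2009_typeI_rate_blowupSequence_of_core KNSS2009_typeI_rate_compactness_holds
    KNSS2009_typeI_rate_liouville_holds KNSS2009_typeI_rate_vertex_holds

/-- **KNSS 2009, proof of Theorem 6.2, Steps 5–6 over mild data — discharged**: the named fact
`KNSS2009_typeI_rate_mildBlowupSequence` of `KNSSTypeIRateMild` holds
(`KNSS2009_typeI_rate_mildBlowupSequence_of_liouville` with `KNSS2009_typeI_rate_liouville_holds`). [cite: KochNadirashviliSereginSverak2009, proof of Thm 6.2, last two paragraphs (arXiv p. 13)] -/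
theorem KNSS2009_typeI_rate_mildBlowupSequence_holds : KNSS2009_typeI_rate_mildBlowupSequence :=
  KNSS2009_typeI_rate_mildBlowupSequence_of_liouville KNSS2009_typeI_rate_liouville_holds

/-- **KNSS 2009, Theorem 6.2, main step (`f = |x'| |u|` is bounded on `ℝ³ × (0, T)`) —
discharged**: the named fact `KNSS2009_typeI_rate_rMulNorm_bounded` of `KNSSTypeIRate` holds
(`KNSS2009_typeI_rate_rMulNorm_bounded_of_liouville` with `KNSS2009_typeI_rate_liouville_holds`). [cite: KochNadirashviliSereginSverak2009, Thm 6.2 and its proof, Steps 1–6 (arXiv pp. 12–13)] -/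
theorem KNSS2009_typeI_rate_rMulNorm_bounded_holds : KNSS2009_typeI_rate_rMulNorm_bounded :=
  KNSS2009_typeI_rate_rMulNorm_bounded_of_liouville KNSS2009_typeI_rate_liouville_holds

/-! ### Theorems 6.1 and 6.2 -/

/-- **KNSS 2009, Theorem 6.1 — discharged**: "Let `u` be an axi-symmetric vector field in
`ℝ³ × (0, T)` which belongs to `L^∞(ℝ³ × (0, T'))` for each `T' < T`. Assume that `u` is a weak
solution of the Navier–Stokes equations in `ℝ³ × (0, T)` and that `|u(x, t)| ≤ C/√(x₁² + x₂²)`.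
Then `|u| ≤ M = M(C)` in `ℝ³ × (0, T)`", in the tree's rendering
`KNSS2009_regularity_bound_C_over_r` (`KNSSTypeII`): the accepted reduction to §4 on finite windows
and Theorem 5.3 (`KNSS2009_regularity_bound_C_over_r_of_window_of_liouville`, `KNSSTypeIIProofs`)
fed with their discharges (`KNSS2009_regularity_boundedWeak_window_holds`,
`KNSS2009_liouville_bound_C_over_r_holds`, `KNSSThm53OfWindow`). [cite: KochNadirashviliSereginSverak2009, Thm 6.1 (arXiv p. 11) and its proof (p. 12)] -/
theorem KNSS2009_regularity_bound_C_over_r_holds : KNSS2009_regularity_bound_C_over_r :=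
  KNSS2009_regularity_bound_C_over_r_of_window_of_liouville
    KNSS2009_regularity_boundedWeak_window_holds KNSS2009_liouville_bound_C_over_r_holds

/-- **KNSS 2009, Theorem 6.2 — discharged**: "Let `u` be an axi-symmetric vector field in
`ℝ³ × (0, T)` which belongs to `L^∞(ℝ³ × (0, T'))` for each `T' < T`. Assume that `u` is a weak
solution of the Navier–Stokes equations in `ℝ³ × (0, T)` satisfying `|u(x, t)| ≤ C/√(T − t)` …
In addition, assume that there exists some `R₀ > 0` such that `|u(x, t)| ≤ C/|x'|` for
`|x'| ≥ R₀`. Then `|u| ≤ M = M(C)` in `ℝ³ × (0, T)`", in the tree's rendering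
`KNSS2009_regularity_typeI_rate` (`KNSSTypeII`): Theorem 6.1
(`KNSS2009_regularity_bound_C_over_r_holds`) and the Liouville step
(`KNSS2009_typeI_rate_liouville_holds`) through the accepted assembly
`KNSS2009_regularity_typeI_rate_of_bound_C_over_r_of_liouville` (`KNSSTypeIRateMildHolds`:
mildness clause, compactness and vertex estimate over mild data all proved there). [cite: KochNadirashviliSereginSverak2009, Thm 6.2 (arXiv p. 12) and its proof (pp. 12–13)] -/
theorem KNSS2009_regularity_typeI_rate_holds : KNSS2009_regularity_typeI_rate :=
  KNSS2009_regularity_typeI_rate_of_bound_C_over_r_of_liouville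
    KNSS2009_regularity_bound_C_over_r_holds KNSS2009_typeI_rate_liouville_holds

/-! ### Remark 6.2: the continuation statements, unconditionally -/

section Continuation

variable {ν T : ℝ} {u : ℝ → EuclideanSpace ℝ (Fin 3) → EuclideanSpace ℝ (Fin 3)}
  {p : ℝ → EuclideanSpace ℝ (Fin 3) → ℝ}

/-- **KNSS 2009, Theorem 6.1 with Remark 6.2, continuation form, unconditional.** A classical
solution of the unforced Navier–Stokes system on `ℝ³ × [0, T)` (`ν > 0`, `T > 0`), Leray–Hopf on
`[0, T)`, bounded on `[0, T'] × ℝ³` for every `T' < T`, with axisymmetric slices and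
`r ‖u(t, x)‖ ≤ C` on `[0, T) × ℝ³` (`r = cylRadius x`), extends as a classical solution past `T`
(the accepted conditional form `hasSmoothExtensionPast_of_cylRadius_mul_norm_le` of `KNSSTypeII`
fed with `KNSS2009_regularity_bound_C_over_r_holds` and the continuation of bounded Leray–Hopf
solutions `hasSmoothExtensionPast_of_bounded_holds`). [cite: KochNadirashviliSereginSverak2009, Thm 6.1 and Remark 6.2 (arXiv p. 11)] -/
theorem hasSmoothExtensionPast_of_axisymmetric_of_cylRadius_mul_norm_le (hν : 0 < ν) (hT : 0 < T)
    (h : IsClassicalNSSolutionOn (Ico 0 T) ν 0 u p) (hLH : IsLerayHopfOn T ν 0 (u 0) u)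
    (hbdd : ∀ T' < T, ∃ M : ℝ, ∀ t ∈ Icc 0 T', ∀ x, ‖u t x‖ ≤ M)
    (haxi : ∀ t ∈ Ico 0 T, IsAxisymmetric (u t))
    (hC : ∃ C : ℝ, ∀ t ∈ Ico 0 T, ∀ x, cylRadius x * ‖u t x‖ ≤ C) :
    HasSmoothExtensionPast ν 0 u T :=
  hasSmoothExtensionPast_of_cylRadius_mul_norm_le KNSS2009_regularity_bound_C_over_r_holds
    hasSmoothExtensionPast_of_bounded_holds hν hT h hLH hbdd haxi hC

/-- **KNSS 2009, Theorem 6.2 with Remark 6.2, continuation form, unconditional.** A classical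
solution of the unforced Navier–Stokes system on `ℝ³ × [0, T)` (`ν > 0`, `T > 0`), Leray–Hopf on
`[0, T)`, bounded on `[0, T'] × ℝ³` for every `T' < T`, with axisymmetric slices, blowing up at
most at the Type I rate at `T` (`IsTypeIBlowup u T`) and with `r ‖u(t, x)‖ ≤ C` for `r ≥ R₀ > 0`,
extends as a classical solution past `T` (the accepted conditional form
`hasSmoothExtensionPast_of_typeI_of_decay` of `KNSSTypeII` fed with
`KNSS2009_regularity_typeI_rate_holds` and `hasSmoothExtensionPast_of_bounded_holds`). [cite: KochNadirashviliSereginSverak2009, Thm 6.2 (arXiv p. 12) and Remark 6.2 (p. 11)] -/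
theorem hasSmoothExtensionPast_of_axisymmetric_typeI_of_decay (hν : 0 < ν) (hT : 0 < T)
    (h : IsClassicalNSSolutionOn (Ico 0 T) ν 0 u p) (hLH : IsLerayHopfOn T ν 0 (u 0) u)
    (hbdd : ∀ T' < T, ∃ M : ℝ, ∀ t ∈ Icc 0 T', ∀ x, ‖u t x‖ ≤ M)
    (haxi : ∀ t ∈ Ico 0 T, IsAxisymmetric (u t)) (hI : IsTypeIBlowup u T)
    (hdecay : ∃ C R₀ : ℝ, 0 < R₀ ∧
      ∀ t ∈ Ico 0 T, ∀ x, R₀ ≤ cylRadius x → cylRadius x * ‖u t x‖ ≤ C) :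
    HasSmoothExtensionPast ν 0 u T :=
  hasSmoothExtensionPast_of_typeI_of_decay KNSS2009_regularity_typeI_rate_holds
    hasSmoothExtensionPast_of_bounded_holds hν hT h hLH hbdd haxi hI hdecay

end Continuation

end Literature.Analysis.FluidPDE

end
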